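import Mathlib
import Literature.MathematicalPhysics.QuantumFieldTheory.BalabanImbrieJaffe1984to88.BIJ88PkDerivatives

/-!
# `BalabanImbrieJaffe1984to88.BIJ88Ineq415Proof` — T. Bałaban, J. Imbrie, A. Jaffe, *Effective action and cluster
properties of the abelian Higgs model*, Commun. Math. Phys. **114** (1988) 257–315 [BalabanImbrieJaffe1988]: Sect. 4
"The Inductive Hypothesis", display **(4.15)** p. 276 — the bounds on the derivatives `P_k^{(l)}(φ_k)` of the dominant scalar
term `P_k` (4.14) at vertices with `l` external legs, PROVED from the restrictions (4.5) on the field value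
(file 2 of 2; file 1 = `BIJ88PkDerivatives`, the master bounds)

statement-level skeleton of published theorems with citation tags; proofs where landed; nothing here is a
claim about the Yang–Mills mass gap

PDF held: `paper:balaban1988-cmp114-bij-abelian-higgs-effective-action` (journal page = PDF page + 256).  The display (4.15)
is lost in the text layer of the scan (PDF p. 20); it is quoted here from the C2 §§1–4 owner's transcription of the page image
(`BIJ88Sect4Statements.Ineq415`, unit `lit-balaban-r18`, row C2.Eq4.15 of `HOME/lit-balaban-r18/ROWS-C2.md`), which is the
row of record; the surrounding sentences of p. 276 are legible in the text layer and quoted verbatim.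

CITATION HEADER (lean-in-tree rule).  lit-balaban TYPED SKELETON, PHASE 2 (HOME `run/shared/lean/pub/lit-balaban/`); proof
seat p27, generation 3 (unit `lit-balaban-p27`; TAKING line HOME/STATUS.md 2026-08-21T02:56:28Z); row owner `lit-balaban-r18`;
referee group ref-5.  WHAT IS REPRODUCED: SKELETON row **C2.Eq4.15** — the typed statement `BIJ88Sect4Statements.Ineq415`
(r18, p240556) PROVED for the concrete dominant term `BIJ88Sect4Statements.Pk` (4.14), the sizes of the derivatives being
instantiated as the operator norms of the real Fréchet derivatives of `P_k : ℂ → ℝ` at the field value (kind «model-instance»: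
`DP l := ‖iteratedFDeriv ℝ l (P_k) φ_k‖`), under the restrictions (4.5) on the field value in exactly the form used by r18's
`BIJ88Sect4Statements.claim276_of_restr45` (which is the case `l = 0`: *"Under the restrictions in χ_k, |P_k(φ_k)| ≦ cp(e_k)⁴"*).

THE PRINTED TEXT (p. 276 [PDF 20]).  *"The dominant term for the scalar field is P_k(φ_k), where
  P_k(φ) = λ_k|φ|⁴ − ¼(L^kε)²|φ|² + (1/64λ)(L^kε)^d.   (4.14)
Under the restrictions in χ_k, |P_k(φ_k)| ≦ cp(e_k)⁴. At P_k-vertices with l external legs, we have its l-th derivative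
  |P_k^{(l)}(φ_k)| ≦ cλ_k^{l/4}p(e_k)^{4−l}, for (L^kε)^d ≦ λ,   |P_k^{(l)}(φ_k)| ≦ c(L^kε)^l p(e_k)^{4−l}, for (L^kε)^d > λ.   (4.15)"*
(display (4.15) as transcribed in `BIJ88Sect4Statements.Ineq415`); p. 275: *"We have incorporated some rescaling factors (powers
of L) and the difference between p(e_k) and p(e_{k−1}) into the constant c."*; the restrictions are (4.5) p. 274: *"|φ(x)| ≦
cλ_k^{−1/4}p(e_k), if (L^{k−1}ε)^d < λ, … ||φ(x)| − (8λ)^{−1/2}(L^kε)^{(d−2)/2}| ≦ c(L^kε)⁻¹p(e_k), if (L^{k−1}ε)^d ≧ λ"*;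
λ_k = (L^kε)^{4−d}λ is (2.2) p. 260 (`BIJ88Sect5Statements.lamK`, r16).

THE PROOF (ours; the paper states (4.15) without proof).  Write `s = L^kε`, `Λ = λ_k`, `u = Λ^{1/4}`, `p = p(e_k) ≥ 1`; the
master bounds of `BIJ88PkDerivatives` (§2 there) bound `‖P_k^{(l)}(φ)‖` by `Λ`, `||φ|² − ρ₀²|` and `|φ|`.  §1 (small-field regime of
(4.5), `(L^{k−1}ε)^d < λ` read as `s^d < L^dλ` as in `claim276_of_restr45`): `|φ| ≦ cu⁻¹p` and `ρ₀² = s²/(8Λ) ≤ √(L^d)/(8u²)` give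
`‖P_k^{(l)}‖ ≤ K_l u^l p^{4−l}`, `K = ((c² + √(L^d)/8)², 4c(c² + √(L^d)/8), 12c² + √(L^d)/2, 24c, 24)`.  §2 (large-field regime,
`λ ≦ s^d`, i.e. `Λ ≤ s⁴`): `||φ| − ρ₀| ≦ cs⁻¹p =: t`, `Λρ₀² = s²/8`, `Λρ₀ ≤ 3s³/8` give `‖P_k^{(l)}‖ ≤ K′_l s^l p^{4−l}`,
`K′ = (c² + 2c⁴, c + 9c²/2 + 4c³, 1 + 9c + 12c², 9 + 24c, 24)`.  §3: the printed case distinction of (4.15) (`s^d ≦ λ` / `s^d > λ`,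
i.e. `s ≤ u` / `u < s`) is served in all four combinations because `u ≤ s` when `λ ≤ s^d` and `u = s` on the overlap — the
*"rescaling factors (powers of L)"* of p. 275 are the `√(L^d)` in `K`; ONE constant serves every `l` and both displays:
`C = 24(1 + c)⁴ + √(L^d)(1 + c)² + L^d/64` (`constants_le`).

WHAT IS TYPED AND PROVED (theorems only; no `def`).  `fourthRoot_facts`; `ineq415_smallField`, `ineq415_largeField` (the two
regimes with the constants `K`, `K′`); `constants_le`; **`ineq415_of_restr45`** — `BIJ88Sect4Statements.Ineq415 C (lamK λ s d) p s λ d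
(fun l ↦ ‖iteratedFDeriv ℝ l (Pk (lamK λ s d) s λ d) φ‖)` for every field value `φ : ℂ` obeying the third or the fourth line of
(4.5), all `d`, `λ > 0`, `s = L^kε > 0`, `c ≥ 0`, `p(e_k) ≥ 1`, `L ≥ 0`; `ineq415_of_restr45'` — the same in r18's parameterization
`λ_k = s^{4−d}λ` (natural-number exponent, `d ≤ 4`; the hypotheses of `claim276_of_restr45`).  NOT ASSERTED: anything about the
minimizer `φ_k = a_kG_{k,loc}(u_k)Q_k^*(u_k)φ` (4.12) beyond its value obeying (4.5) (the paper's *"Under the restrictions in χ_k"*;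
as in `Claim276` the restriction is a hypothesis on the value), and the non-dominant terms of p. 276 (`NonDominantBound`,
deferred in print to a later paper).  No `sorry`; axioms of every theorem ⊆ {propext, Classical.choice, Quot.sound}.
v1.1 (same seat, append-only §4): `ineq415_of_Restr45` — (4.15) at every site of the region from r18's typed (4.5) predicate
`BIJ88Sect4Statements.Restr45` itself (`s₁ = L^{k−1}ε = s/L`, `L ≥ 1`); `abs_Pk_le_of_Restr45` — the p. 276 claim
*"Under the restrictions in χ_k, |P_k(φ_k)| ≦ cp(e_k)⁴"* from `Restr45`, every `d`.
-/

namespace Literature.MathematicalPhysics.QuantumFieldTheory.BalabanImbrieJaffe1984to88.BIJ88Ineq415Proof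

open BIJ88Sect5Statements (lamK rho0 lamK_mul_rho0_sq rho0_sq)
open BIJ88PkDerivatives
open scoped BigOperators

noncomputable section

variable {lam s : ℝ}

/-! ## §1. The small-field regime of (4.5): `|φ| ≦ cλ_k^{−1/4}p(e_k)`, `(L^kε)^d < L^dλ` -/

/-- kernel: the fourth root `u = λ_k^{1/4}`: `u > 0`, `u⁴ = λ_k`, `λ_k^{−1/4} = u⁻¹`, `λ_k^{l/4} = u^l`. [cite: BalabanImbrieJaffe1988, (4.15) p.276] -/
theorem fourthRoot_facts {Λ : ℝ} (hΛ : 0 < Λ) :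
    0 < Λ ^ (1 / 4 : ℝ) ∧ (Λ ^ (1 / 4 : ℝ)) ^ 4 = Λ ∧ Λ ^ (-(1 / 4 : ℝ)) = (Λ ^ (1 / 4 : ℝ))⁻¹ ∧
      ∀ l : ℕ, Λ ^ ((l : ℝ) / 4) = (Λ ^ (1 / 4 : ℝ)) ^ l := by
  refine ⟨Real.rpow_pos_of_pos hΛ _, ?_, Real.rpow_neg hΛ.le _, fun l => ?_⟩
  · rw [← Real.rpow_natCast (Λ ^ (1 / 4 : ℝ)) 4, ← Real.rpow_mul hΛ.le]; norm_num
  · rw [← Real.rpow_natCast (Λ ^ (1 / 4 : ℝ)) l, ← Real.rpow_mul hΛ.le]; congr 1; ring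

/-- **(4.15) in the small-field regime of (4.5)** — for `λ > 0`, `s = L^kε > 0`, `L ≥ 0`, `p = p(e_k) ≥ 1`, any real `c`, all `d`:
if `s^d < L^dλ` (the (4.5) case `(L^{k−1}ε)^d < λ`) and `|φ| ≦ cλ_k^{−1/4}p`, then with `u = λ_k^{1/4}`
`‖P_k^{(l)}(φ)‖ ≤ K_l u^l p^{4−l}`, `K = ((c² + √(L^d)/8)², 4c(c² + √(L^d)/8), 12c² + √(L^d)/2, 24c, 24)`, `l = 0, …, 4`.
[cite: BalabanImbrieJaffe1988, (4.15) p.276] -/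
theorem ineq415_smallField (hlam : 0 < lam) (hs : 0 < s) {L c pek : ℝ} (hL : 0 ≤ L) (hp : 1 ≤ pek) (d : ℕ)
    (hsd : s ^ d < L ^ d * lam) (z : ℂ) (hz : ‖z‖ ≤ c * (lamK lam s d) ^ (-(1 / 4 : ℝ)) * pek) :
    ‖iteratedFDeriv ℝ 0 (BIJ88Sect4Statements.Pk (lamK lam s d) s lam d) z‖ ≤
        (c ^ 2 + Real.sqrt (L ^ d) / 8) ^ 2 * pek ^ 4 ∧
      ‖iteratedFDeriv ℝ 1 (BIJ88Sect4Statements.Pk (lamK lam s d) s lam d) z‖ ≤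
        4 * c * (c ^ 2 + Real.sqrt (L ^ d) / 8) * (lamK lam s d) ^ (1 / 4 : ℝ) * pek ^ 3 ∧
      ‖iteratedFDeriv ℝ 2 (BIJ88Sect4Statements.Pk (lamK lam s d) s lam d) z‖ ≤
        (12 * c ^ 2 + Real.sqrt (L ^ d) / 2) * ((lamK lam s d) ^ (1 / 4 : ℝ)) ^ 2 * pek ^ 2 ∧
      ‖iteratedFDeriv ℝ 3 (BIJ88Sect4Statements.Pk (lamK lam s d) s lam d) z‖ ≤
        24 * c * ((lamK lam s d) ^ (1 / 4 : ℝ)) ^ 3 * pek ∧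
      ‖iteratedFDeriv ℝ 4 (BIJ88Sect4Statements.Pk (lamK lam s d) s lam d) z‖ ≤ 24 * ((lamK lam s d) ^ (1 / 4 : ℝ)) ^ 4 := by
  set Λ := lamK lam s d with hΛdef
  have hΛ : 0 < Λ := lamK_pos hlam hs d
  obtain ⟨hu, hu4, hneg, -⟩ := fourthRoot_facts hΛ
  set u := Λ ^ (1 / 4 : ℝ) with hudef
  set R := Real.sqrt (L ^ d) with hRdef
  have hR : 0 ≤ R := Real.sqrt_nonneg _
  set ρ := rho0 lam s d with hρdef
  have hρ : 0 ≤ ρ := Real.sqrt_nonneg _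
  -- the hypothesis: ‖z‖ ≤ c p / u
  rw [hneg] at hz
  have hM : ‖z‖ * u ≤ c * pek := by
    calc ‖z‖ * u ≤ c * u⁻¹ * pek * u := mul_le_mul_of_nonneg_right hz hu.le
      _ = c * pek := by field_simp
  have hM0 : 0 ≤ ‖z‖ := norm_nonneg z
  -- ρ² u² ≤ R/8 : from Λ ρ² = s²/8, s⁴ < L^d Λ = L^d u⁴ hence s² ≤ R u²
  have hρu : ρ ^ 2 * u ^ 2 ≤ R / 8 := by
    have hkey : Λ * ρ ^ 2 = s ^ 2 / 8 := lamK_mul_rho0_sq hlam hs d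
    have hs4 : s ^ 4 < L ^ d * Λ := pow_four_lt_of_smallField hs lam d hsd
    have hs2 : s ^ 2 ≤ R * u ^ 2 := by
      have h1 : s ^ 2 = Real.sqrt (s ^ 4) := by
        rw [show s ^ 4 = (s ^ 2) ^ 2 by ring, Real.sqrt_sq (by positivity)]
      have h2 : R * u ^ 2 = Real.sqrt (L ^ d * u ^ 4) := by
        rw [Real.sqrt_mul (pow_nonneg hL d), show u ^ 4 = (u ^ 2) ^ 2 by ring, Real.sqrt_sq (by positivity)]
      rw [h1, h2]
      exact Real.sqrt_le_sqrt (by rw [hu4]; exact hs4.le)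
    -- ρ² u² = (s²/8) u² / Λ = (s²/8)/u² ≤ R/8
    have : ρ ^ 2 * u ^ 2 * u ^ 2 ≤ R / 8 * u ^ 2 := by
      calc ρ ^ 2 * u ^ 2 * u ^ 2 = Λ * ρ ^ 2 := by rw [← hu4]; ring
        _ = s ^ 2 / 8 := hkey
        _ ≤ R * u ^ 2 / 8 := by gcongr
        _ = R / 8 * u ^ 2 := by ring
    exact le_of_mul_le_mul_right this (by positivity)
  -- |‖z‖² − ρ²| u² ≤ (c² + R/8) p²
  have hp0 : 0 ≤ pek := zero_le_one.trans hp
  have hp1 : 1 ≤ pek ^ 2 := one_le_pow₀ hp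
  have hG : |‖z‖ ^ 2 - ρ ^ 2| * u ^ 2 ≤ (c ^ 2 + R / 8) * pek ^ 2 := by
    have hG1 : |‖z‖ ^ 2 - ρ ^ 2| ≤ ‖z‖ ^ 2 + ρ ^ 2 := by
      rw [abs_le]; constructor <;> nlinarith [sq_nonneg ‖z‖, sq_nonneg ρ]
    calc |‖z‖ ^ 2 - ρ ^ 2| * u ^ 2 ≤ (‖z‖ ^ 2 + ρ ^ 2) * u ^ 2 := by gcongr
      _ = (‖z‖ * u) ^ 2 + ρ ^ 2 * u ^ 2 := by ring
      _ ≤ (c * pek) ^ 2 + R / 8 := by gcongr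
      _ ≤ (c * pek) ^ 2 + R / 8 * pek ^ 2 := by gcongr; exact le_mul_of_one_le_right (by positivity) hp1
      _ = (c ^ 2 + R / 8) * pek ^ 2 := by ring
  have hG0 : 0 ≤ |‖z‖ ^ 2 - ρ ^ 2| := abs_nonneg _
  have hK : 0 ≤ c ^ 2 + R / 8 := by positivity
  refine ⟨?_, ?_, ?_, ?_, ?_⟩
  · -- l = 0 : Λ G² = (G u²)² ≤ (c²+R/8)² p⁴
    rw [norm_iteratedFDeriv_Pk_zero hlam hs]
    calc Λ * (‖z‖ ^ 2 - ρ ^ 2) ^ 2 = (|‖z‖ ^ 2 - ρ ^ 2| * u ^ 2) ^ 2 := by rw [← hu4, mul_pow, sq_abs]; ring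
      _ ≤ ((c ^ 2 + R / 8) * pek ^ 2) ^ 2 := by gcongr
      _ = (c ^ 2 + R / 8) ^ 2 * pek ^ 4 := by ring
  · -- l = 1 : 4 Λ G ‖z‖ = 4 (G u²) (‖z‖ u) u ≤ 4 (c²+R/8) p² · c p · u
    refine (norm_iteratedFDeriv_Pk_one_le hlam hs d z).trans ?_
    calc 4 * Λ * |‖z‖ ^ 2 - ρ ^ 2| * ‖z‖ = 4 * (|‖z‖ ^ 2 - ρ ^ 2| * u ^ 2) * (‖z‖ * u) * u := by rw [← hu4]; ring
      _ ≤ 4 * ((c ^ 2 + R / 8) * pek ^ 2) * (c * pek) * u := by gcongr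
      _ = 4 * c * (c ^ 2 + R / 8) * u * pek ^ 3 := by ring
  · -- l = 2 : Λ (4G + 8‖z‖²) = (4 G u² + 8 (‖z‖u)²) u² ≤ (4(c²+R/8) + 8c²) p² u²
    refine (norm_iteratedFDeriv_Pk_two_le hlam hs d z).trans ?_
    calc Λ * (4 * |‖z‖ ^ 2 - ρ ^ 2| + 8 * ‖z‖ ^ 2)
        = (4 * (|‖z‖ ^ 2 - ρ ^ 2| * u ^ 2) + 8 * (‖z‖ * u) ^ 2) * u ^ 2 := by rw [← hu4]; ring
      _ ≤ (4 * ((c ^ 2 + R / 8) * pek ^ 2) + 8 * (c * pek) ^ 2) * u ^ 2 := by gcongr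
      _ = (12 * c ^ 2 + R / 2) * u ^ 2 * pek ^ 2 := by ring
  · -- l = 3 : 24 Λ ‖z‖ = 24 (‖z‖ u) u³ ≤ 24 c p u³
    refine (norm_iteratedFDeriv_Pk_three_le hlam hs d z).trans ?_
    calc 24 * Λ * ‖z‖ = 24 * (‖z‖ * u) * u ^ 3 := by rw [← hu4]; ring
      _ ≤ 24 * (c * pek) * u ^ 3 := by gcongr
      _ = 24 * c * u ^ 3 * pek := by ring
  · -- l = 4
    refine (norm_iteratedFDeriv_Pk_four_le hlam hs d z).trans (le_of_eq ?_)
    rw [hu4]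

/-! ## §2. The large-field regime of (4.5): `||φ| − ρ₀| ≦ c(L^kε)⁻¹p(e_k)`, `λ ≦ (L^kε)^d` -/

/-- **(4.15) in the large-field regime of (4.5)** — for `λ > 0`, `s = L^kε > 0`, `c ≥ 0`, `p = p(e_k) ≥ 1`, all `d`: if
`λ ≦ s^d` (the (4.5) case `(L^{k−1}ε)^d ≧ λ`; equivalently `λ_k ≤ s⁴`) and `||φ| − ρ₀| ≦ cs⁻¹p`, then
`‖P_k^{(l)}(φ)‖ ≤ K′_l s^l p^{4−l}`, `K′ = (c² + 2c⁴, c + 9c²/2 + 4c³, 1 + 9c + 12c², 9 + 24c, 24)`, `l = 0, …, 4`.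
[cite: BalabanImbrieJaffe1988, (4.15) p.276] -/
theorem ineq415_largeField (hlam : 0 < lam) (hs : 0 < s) {c pek : ℝ} (hc : 0 ≤ c) (hp : 1 ≤ pek) (d : ℕ)
    (hsd : lam ≤ s ^ d) (z : ℂ) (hz : |‖z‖ - rho0 lam s d| ≤ c * s⁻¹ * pek) :
    ‖iteratedFDeriv ℝ 0 (BIJ88Sect4Statements.Pk (lamK lam s d) s lam d) z‖ ≤ (c ^ 2 + 2 * c ^ 4) * pek ^ 4 ∧
      ‖iteratedFDeriv ℝ 1 (BIJ88Sect4Statements.Pk (lamK lam s d) s lam d) z‖ ≤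
        (c + 9 / 2 * c ^ 2 + 4 * c ^ 3) * s * pek ^ 3 ∧
      ‖iteratedFDeriv ℝ 2 (BIJ88Sect4Statements.Pk (lamK lam s d) s lam d) z‖ ≤
        (1 + 9 * c + 12 * c ^ 2) * s ^ 2 * pek ^ 2 ∧
      ‖iteratedFDeriv ℝ 3 (BIJ88Sect4Statements.Pk (lamK lam s d) s lam d) z‖ ≤ (9 + 24 * c) * s ^ 3 * pek ∧
      ‖iteratedFDeriv ℝ 4 (BIJ88Sect4Statements.Pk (lamK lam s d) s lam d) z‖ ≤ 24 * s ^ 4 := by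
  set Λ := lamK lam s d with hΛdef
  have hΛ : 0 < Λ := lamK_pos hlam hs d
  have hΛs : Λ ≤ s ^ 4 := (le_pow_iff_lamK_le_pow_four hs lam d).mp hsd
  set ρ := rho0 lam s d with hρdef
  have hρ : 0 ≤ ρ := Real.sqrt_nonneg _
  have hkey : Λ * ρ ^ 2 = s ^ 2 / 8 := lamK_mul_rho0_sq hlam hs d
  have hΛρ : Λ * ρ ≤ 3 * s ^ 3 / 8 := lamK_mul_rho0_le hlam hs d hΛs
  set t := c * s⁻¹ * pek with htdef
  have ht : 0 ≤ t := by positivity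
  have hst : s * t = c * pek := by rw [htdef]; field_simp
  have hp0 : 0 ≤ pek := zero_le_one.trans hp
  have hM0 : 0 ≤ ‖z‖ := norm_nonneg z
  -- ‖z‖ ≤ ρ + t and |‖z‖² − ρ²| ≤ t (2ρ + t)
  have hMle : ‖z‖ ≤ ρ + t := by have := (abs_le.mp hz).2; linarith
  have hG : |‖z‖ ^ 2 - ρ ^ 2| ≤ t * (2 * ρ + t) := by
    rw [show ‖z‖ ^ 2 - ρ ^ 2 = (‖z‖ - ρ) * (‖z‖ + ρ) by ring, abs_mul, abs_of_nonneg (by positivity : 0 ≤ ‖z‖ + ρ)]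
    exact mul_le_mul hz (by linarith) (by positivity) ht
  have hG0 : 0 ≤ |‖z‖ ^ 2 - ρ ^ 2| := abs_nonneg _
  -- powers of p
  have hp2 : pek ≤ pek ^ 2 := by nlinarith
  have hp3 : pek ^ 2 ≤ pek ^ 3 := by nlinarith
  have hp4 : pek ^ 2 ≤ pek ^ 4 := by nlinarith
  have hp13 : pek ≤ pek ^ 3 := hp2.trans hp3
  -- Λ t^k ≤ s⁴ t^k, and s^j t^j = (c p)^j
  refine ⟨?_, ?_, ?_, ?_, ?_⟩
  · -- l = 0 : Λ G² ≤ Λ t²(2ρ+t)² ≤ 2Λt²(4ρ² + t²) = 8Λρ² t² + 2Λ t⁴ = s² t² + 2 Λ t⁴ ≤ c²p² + 2 c⁴ p⁴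
    rw [norm_iteratedFDeriv_Pk_zero hlam hs]
    have h1 : (‖z‖ ^ 2 - ρ ^ 2) ^ 2 ≤ (t * (2 * ρ + t)) ^ 2 := by
      rw [← sq_abs (‖z‖ ^ 2 - ρ ^ 2)]; gcongr
    have h2 : (2 * ρ + t) ^ 2 ≤ 2 * (4 * ρ ^ 2 + t ^ 2) := by nlinarith [sq_nonneg (2 * ρ - t)]
    calc Λ * (‖z‖ ^ 2 - ρ ^ 2) ^ 2 ≤ Λ * (t * (2 * ρ + t)) ^ 2 := by gcongr
      _ = Λ * t ^ 2 * (2 * ρ + t) ^ 2 := by ring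
      _ ≤ Λ * t ^ 2 * (2 * (4 * ρ ^ 2 + t ^ 2)) := by gcongr
      _ = 8 * (Λ * ρ ^ 2) * t ^ 2 + 2 * Λ * t ^ 4 := by ring
      _ ≤ 8 * (Λ * ρ ^ 2) * t ^ 2 + 2 * s ^ 4 * t ^ 4 := by gcongr
      _ = (s * t) ^ 2 + 2 * (s * t) ^ 4 := by rw [hkey]; ring
      _ = c ^ 2 * pek ^ 2 + 2 * c ^ 4 * pek ^ 4 := by rw [hst]; ring
      _ ≤ c ^ 2 * pek ^ 4 + 2 * c ^ 4 * pek ^ 4 := by gcongr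
      _ = (c ^ 2 + 2 * c ^ 4) * pek ^ 4 := by ring
  · -- l = 1 : 4ΛG‖z‖ ≤ 4Λ t(2ρ+t)(ρ+t) = 8Λρ²t + 12Λρt² + 4Λt³ ≤ s²t + 12(3s³/8)t² + 4s⁴t³
    refine (norm_iteratedFDeriv_Pk_one_le hlam hs d z).trans ?_
    calc 4 * Λ * |‖z‖ ^ 2 - ρ ^ 2| * ‖z‖ ≤ 4 * Λ * (t * (2 * ρ + t)) * (ρ + t) := by gcongr
      _ = 8 * (Λ * ρ ^ 2) * t + 12 * (Λ * ρ) * t ^ 2 + 4 * Λ * t ^ 3 := by ring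
      _ ≤ 8 * (Λ * ρ ^ 2) * t + 12 * (3 * s ^ 3 / 8) * t ^ 2 + 4 * s ^ 4 * t ^ 3 := by gcongr
      _ = (s * t) * s + 9 / 2 * (s * t) ^ 2 * s + 4 * (s * t) ^ 3 * s := by rw [hkey]; ring
      _ = c * s * pek + 9 / 2 * c ^ 2 * s * pek ^ 2 + 4 * c ^ 3 * s * pek ^ 3 := by rw [hst]; ring
      _ ≤ c * s * pek ^ 3 + 9 / 2 * c ^ 2 * s * pek ^ 3 + 4 * c ^ 3 * s * pek ^ 3 := by gcongr
      _ = (c + 9 / 2 * c ^ 2 + 4 * c ^ 3) * s * pek ^ 3 := by ring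
  · -- l = 2 : Λ(4G + 8‖z‖²) ≤ Λ(4t(2ρ+t) + 8(ρ+t)²) = 8Λρ² + 24Λρt + 12Λt² ≤ s² + 9 s² (st) + 12 s² (st)²
    refine (norm_iteratedFDeriv_Pk_two_le hlam hs d z).trans ?_
    have hM2 : ‖z‖ ^ 2 ≤ (ρ + t) ^ 2 := by gcongr
    calc Λ * (4 * |‖z‖ ^ 2 - ρ ^ 2| + 8 * ‖z‖ ^ 2) ≤ Λ * (4 * (t * (2 * ρ + t)) + 8 * (ρ + t) ^ 2) := by gcongr
      _ = 8 * (Λ * ρ ^ 2) + 24 * (Λ * ρ) * t + 12 * Λ * t ^ 2 := by ring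
      _ ≤ 8 * (Λ * ρ ^ 2) + 24 * (3 * s ^ 3 / 8) * t + 12 * s ^ 4 * t ^ 2 := by gcongr
      _ = s ^ 2 + 9 * (s * t) * s ^ 2 + 12 * (s * t) ^ 2 * s ^ 2 := by rw [hkey]; ring
      _ = s ^ 2 * 1 + 9 * c * s ^ 2 * pek + 12 * c ^ 2 * s ^ 2 * pek ^ 2 := by rw [hst]; ring
      _ ≤ s ^ 2 * pek ^ 2 + 9 * c * s ^ 2 * pek ^ 2 + 12 * c ^ 2 * s ^ 2 * pek ^ 2 := by
          gcongr
          exact one_le_pow₀ hp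
      _ = (1 + 9 * c + 12 * c ^ 2) * s ^ 2 * pek ^ 2 := by ring
  · -- l = 3 : 24Λ‖z‖ ≤ 24Λρ + 24Λt ≤ 9 s³ + 24 s⁴ t
    refine (norm_iteratedFDeriv_Pk_three_le hlam hs d z).trans ?_
    calc 24 * Λ * ‖z‖ ≤ 24 * Λ * (ρ + t) := by gcongr
      _ = 24 * (Λ * ρ) + 24 * Λ * t := by ring
      _ ≤ 24 * (3 * s ^ 3 / 8) + 24 * s ^ 4 * t := by gcongr
      _ = 9 * s ^ 3 * 1 + 24 * (s * t) * s ^ 3 := by ring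
      _ = 9 * s ^ 3 * 1 + 24 * c * s ^ 3 * pek := by rw [hst]; ring
      _ ≤ 9 * s ^ 3 * pek + 24 * c * s ^ 3 * pek := by gcongr
      _ = (9 + 24 * c) * s ^ 3 * pek := by ring
  · -- l = 4
    refine (norm_iteratedFDeriv_Pk_four_le hlam hs d z).trans ?_
    gcongr

/-! ## §3. (4.15) as typed: `BIJ88Sect4Statements.Ineq415` for the concrete `P_k`, one constant `C(c, L, d)` -/

/-- kernel: the constants `K_l`, `K′_l` of §§1–2 are all `≤ C = 24(1 + c)⁴ + √(L^d)(1 + c)² + L^d/64` (`c, L ≥ 0`).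
[cite: BalabanImbrieJaffe1988, (4.15) p.276] -/
theorem constants_le {c L : ℝ} (hc : 0 ≤ c) (hL : 0 ≤ L) (d : ℕ) :
    (c ^ 2 + Real.sqrt (L ^ d) / 8) ^ 2 ≤ 24 * (1 + c) ^ 4 + Real.sqrt (L ^ d) * (1 + c) ^ 2 + L ^ d / 64 ∧
      4 * c * (c ^ 2 + Real.sqrt (L ^ d) / 8) ≤ 24 * (1 + c) ^ 4 + Real.sqrt (L ^ d) * (1 + c) ^ 2 + L ^ d / 64 ∧
      12 * c ^ 2 + Real.sqrt (L ^ d) / 2 ≤ 24 * (1 + c) ^ 4 + Real.sqrt (L ^ d) * (1 + c) ^ 2 + L ^ d / 64 ∧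
      24 * c ≤ 24 * (1 + c) ^ 4 + Real.sqrt (L ^ d) * (1 + c) ^ 2 + L ^ d / 64 ∧
      (24 : ℝ) ≤ 24 * (1 + c) ^ 4 + Real.sqrt (L ^ d) * (1 + c) ^ 2 + L ^ d / 64 ∧
      c ^ 2 + 2 * c ^ 4 ≤ 24 * (1 + c) ^ 4 + Real.sqrt (L ^ d) * (1 + c) ^ 2 + L ^ d / 64 ∧
      c + 9 / 2 * c ^ 2 + 4 * c ^ 3 ≤ 24 * (1 + c) ^ 4 + Real.sqrt (L ^ d) * (1 + c) ^ 2 + L ^ d / 64 ∧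
      1 + 9 * c + 12 * c ^ 2 ≤ 24 * (1 + c) ^ 4 + Real.sqrt (L ^ d) * (1 + c) ^ 2 + L ^ d / 64 ∧
      9 + 24 * c ≤ 24 * (1 + c) ^ 4 + Real.sqrt (L ^ d) * (1 + c) ^ 2 + L ^ d / 64 := by
  set R := Real.sqrt (L ^ d) with hRdef
  have hR : 0 ≤ R := Real.sqrt_nonneg _
  have hLd : 0 ≤ L ^ d := pow_nonneg hL d
  have hR2 : R ^ 2 = L ^ d := Real.sq_sqrt hLd
  have hc2 : 0 ≤ c ^ 2 := by positivity
  have hc3 : 0 ≤ c ^ 3 := by positivity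
  have hc4 : 0 ≤ c ^ 4 := by positivity
  have hRc : 0 ≤ R * c := by positivity
  have hRc2 : 0 ≤ R * c ^ 2 := by positivity
  have h4 : (1 + c) ^ 4 = 1 + 4 * c + 6 * c ^ 2 + 4 * c ^ 3 + c ^ 4 := by ring
  have h2 : (1 + c) ^ 2 = 1 + 2 * c + c ^ 2 := by ring
  refine ⟨?_, ?_, ?_, ?_, ?_, ?_, ?_, ?_, ?_⟩ <;> nlinarith

/-- **(4.15) PROVED for the dominant term (4.14)** (row C2.Eq4.15; model instance: `P_k^{(l)}(φ_k)` = the `l`-th real Fréchet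
derivative of `P_k : ℂ → ℝ` at the field value, measured in operator norm).  For `λ > 0`, `s = L^kε > 0`, `L ≥ 0`, `c ≥ 0`,
`p(e_k) ≥ 1`, any `d`, and a field value `φ` obeying the third or the fourth line of (4.5) according to the case `(L^{k−1}ε)^d < λ`
/ `≧ λ` (read, as in `BIJ88Sect4Statements.claim276_of_restr45`, as `(L^kε)^d < L^dλ` / `λ ≦ (L^kε)^d`):
`BIJ88Sect4Statements.Ineq415 C λ_k p(e_k) (L^kε) λ d (l ↦ ‖P_k^{(l)}(φ)‖)` with `λ_k = (L^kε)^{4−d}λ` (`BIJ88Sect5Statements.lamK`)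
and the explicit constant `C = 24(1 + c)⁴ + √(L^d)(1 + c)² + L^d/64`, i.e. verbatim *"|P_k^{(l)}(φ_k)| ≦ Cλ_k^{l/4}p(e_k)^{4−l}, for
(L^kε)^d ≦ λ, |P_k^{(l)}(φ_k)| ≦ C(L^kε)^lp(e_k)^{4−l}, for (L^kε)^d > λ"* for every `l`. [cite: BalabanImbrieJaffe1988, (4.15) p.276] -/
theorem ineq415_of_restr45 (hlam : 0 < lam) (hs : 0 < s) {L c pek : ℝ} (hL : 0 ≤ L) (hc : 0 ≤ c) (hp : 1 ≤ pek)
    (d : ℕ) (z : ℂ)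
    (hz : (s ^ d < L ^ d * lam ∧ ‖z‖ ≤ c * (lamK lam s d) ^ (-(1 / 4 : ℝ)) * pek) ∨
      (lam ≤ s ^ d ∧ |‖z‖ - (8 * lam) ^ (-(1 / 2 : ℝ)) * s ^ (((d : ℝ) - 2) / 2)| ≤ c * s⁻¹ * pek)) :
    BIJ88Sect4Statements.Ineq415 (24 * (1 + c) ^ 4 + Real.sqrt (L ^ d) * (1 + c) ^ 2 + L ^ d / 64) (lamK lam s d) pek s
      lam d (fun l => ‖iteratedFDeriv ℝ l (BIJ88Sect4Statements.Pk (lamK lam s d) s lam d) z‖) := by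
  obtain ⟨hK0, hK1, hK2, hK3, hK4, hK0', hK1', hK2', hK3'⟩ := constants_le hc hL d
  have hC : 0 ≤ 24 * (1 + c) ^ 4 + Real.sqrt (L ^ d) * (1 + c) ^ 2 + L ^ d / 64 := le_trans (by norm_num) hK4
  have hΛ : 0 < lamK lam s d := lamK_pos hlam hs d
  obtain ⟨hu, hu4, -, hul⟩ := fourthRoot_facts hΛ
  have hp0 : 0 < pek := zero_lt_one.trans_le hp
  -- regime facts: s^d ≤ λ ⟹ s ≤ u, λ < s^d (or λ ≤ s^d) ⟹ u ≤ s, for u = λ_k^{1/4}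
  have hA : s ^ d ≤ lam → s ≤ lamK lam s d ^ (1 / 4 : ℝ) := fun h => by
    have h4 : s ^ 4 ≤ (lamK lam s d ^ (1 / 4 : ℝ)) ^ 4 := by
      rw [hu4]; exact (pow_le_iff_pow_four_le_lamK hs lam d).mp h
    exact (pow_le_pow_iff_left₀ hs.le hu.le (by norm_num)).mp h4
  have hB : lam ≤ s ^ d → lamK lam s d ^ (1 / 4 : ℝ) ≤ s := fun h => by
    have h4 : (lamK lam s d ^ (1 / 4 : ℝ)) ^ 4 ≤ s ^ 4 := by
      rw [hu4]; exact (le_pow_iff_lamK_le_pow_four hs lam d).mp h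
    exact (pow_le_pow_iff_left₀ hu.le hs.le (by norm_num)).mp h4
  intro l
  simp only [abs_of_nonneg (norm_nonneg _)]
  rw [hul l]
  -- l ≥ 5: the derivative vanishes
  rcases le_or_gt 5 l with hl5 | hl5
  · rw [iteratedFDeriv_Pk_eq_zero hlam hs d z hl5, norm_zero]
    exact ⟨fun _ => by positivity, fun _ => by positivity⟩
  rcases hz with ⟨hsd, hz⟩ | ⟨hsd, hz⟩
  · -- small-field hypothesis: ‖P^{(l)}‖ ≤ K_l u^l p^{4−l} ≤ C u^l p^{4−l}; the second display via u ≤ s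
    obtain ⟨h0, h1, h2, h3, h4⟩ := ineq415_smallField hlam hs hL hp d hsd z hz
    have main : ‖iteratedFDeriv ℝ l (BIJ88Sect4Statements.Pk (lamK lam s d) s lam d) z‖ ≤
        (24 * (1 + c) ^ 4 + Real.sqrt (L ^ d) * (1 + c) ^ 2 + L ^ d / 64) * (lamK lam s d ^ (1 / 4 : ℝ)) ^ l *
          pek ^ ((4 : ℤ) - l) := by
      interval_cases l
      · rw [show ((4 : ℤ) - ((0 : ℕ) : ℤ)) = 4 by norm_num, zpow_ofNat, pow_zero, mul_one]
        exact h0.trans (mul_le_mul_of_nonneg_right hK0 (by positivity))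
      · rw [show ((4 : ℤ) - ((1 : ℕ) : ℤ)) = 3 by norm_num, zpow_ofNat, pow_one]
        exact h1.trans (mul_le_mul_of_nonneg_right (mul_le_mul_of_nonneg_right hK1 hu.le) (by positivity))
      · rw [show ((4 : ℤ) - ((2 : ℕ) : ℤ)) = 2 by norm_num, zpow_ofNat]
        exact h2.trans (mul_le_mul_of_nonneg_right (mul_le_mul_of_nonneg_right hK2 (by positivity)) (by positivity))
      · rw [show ((4 : ℤ) - ((3 : ℕ) : ℤ)) = 1 by norm_num, zpow_one]
        exact h3.trans (mul_le_mul_of_nonneg_right (mul_le_mul_of_nonneg_right hK3 (by positivity)) hp0.le)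
      · rw [show ((4 : ℤ) - ((4 : ℕ) : ℤ)) = 0 by norm_num, zpow_zero, mul_one]
        exact h4.trans (mul_le_mul_of_nonneg_right hK4 (by positivity))
    refine ⟨fun _ => main, fun hlt => main.trans ?_⟩
    have hus : (lamK lam s d ^ (1 / 4 : ℝ)) ^ l ≤ s ^ l := pow_le_pow_left₀ hu.le (hB hlt.le) l
    have : 0 < pek ^ ((4 : ℤ) - l) := zpow_pos hp0 _
    gcongr
  · -- large-field hypothesis: ‖P^{(l)}‖ ≤ K′_l s^l p^{4−l} ≤ C s^l p^{4−l}; the first display via s = u on the overlap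
    rw [ringRadius_eq_rho0 hlam hs] at hz
    obtain ⟨h0, h1, h2, h3, h4⟩ := ineq415_largeField hlam hs hc hp d hsd z hz
    have main : ‖iteratedFDeriv ℝ l (BIJ88Sect4Statements.Pk (lamK lam s d) s lam d) z‖ ≤
        (24 * (1 + c) ^ 4 + Real.sqrt (L ^ d) * (1 + c) ^ 2 + L ^ d / 64) * s ^ l * pek ^ ((4 : ℤ) - l) := by
      interval_cases l
      · rw [show ((4 : ℤ) - ((0 : ℕ) : ℤ)) = 4 by norm_num, zpow_ofNat, pow_zero, mul_one]
        exact h0.trans (mul_le_mul_of_nonneg_right hK0' (by positivity))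
      · rw [show ((4 : ℤ) - ((1 : ℕ) : ℤ)) = 3 by norm_num, zpow_ofNat, pow_one]
        exact h1.trans (mul_le_mul_of_nonneg_right (mul_le_mul_of_nonneg_right hK1' hs.le) (by positivity))
      · rw [show ((4 : ℤ) - ((2 : ℕ) : ℤ)) = 2 by norm_num, zpow_ofNat]
        exact h2.trans (mul_le_mul_of_nonneg_right (mul_le_mul_of_nonneg_right hK2' (by positivity)) (by positivity))
      · rw [show ((4 : ℤ) - ((3 : ℕ) : ℤ)) = 1 by norm_num, zpow_one]
        exact h3.trans (mul_le_mul_of_nonneg_right (mul_le_mul_of_nonneg_right hK3' (by positivity)) hp0.le)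
      · rw [show ((4 : ℤ) - ((4 : ℕ) : ℤ)) = 0 by norm_num, zpow_zero, mul_one]
        exact h4.trans (mul_le_mul_of_nonneg_right hK4 (by positivity))
    refine ⟨fun hle => main.trans (le_of_eq ?_), fun _ => main⟩
    have hsu : lamK lam s d ^ (1 / 4 : ℝ) = s := le_antisymm (hB hsd) (hA hle)
    rw [hsu]

/-- **(4.15)** in r18's parameterization of `claim276_of_restr45` (`λ_k = s^{4−d}λ` with a natural-number exponent, `d ≤ 4`;
the paper has d = 2, 3): the same statement with `BIJ88Sect4Statements.Pk (s^{4−d}λ) s λ d`. [cite: BalabanImbrieJaffe1988, (4.15) p.276] -/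
theorem ineq415_of_restr45' (hlam : 0 < lam) (hs : 0 < s) {L c pek : ℝ} (hL : 0 ≤ L) (hc : 0 ≤ c) (hp : 1 ≤ pek)
    {d : ℕ} (hd : d ≤ 4) (z : ℂ)
    (hz : (s ^ d < L ^ d * lam ∧ ‖z‖ ≤ c * (s ^ (4 - d) * lam) ^ (-(1 / 4 : ℝ)) * pek) ∨
      (lam ≤ s ^ d ∧ |‖z‖ - (8 * lam) ^ (-(1 / 2 : ℝ)) * s ^ (((d : ℝ) - 2) / 2)| ≤ c * s⁻¹ * pek)) :
    BIJ88Sect4Statements.Ineq415 (24 * (1 + c) ^ 4 + Real.sqrt (L ^ d) * (1 + c) ^ 2 + L ^ d / 64) (s ^ (4 - d) * lam) pek s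
      lam d (fun l => ‖iteratedFDeriv ℝ l (BIJ88Sect4Statements.Pk (s ^ (4 - d) * lam) s lam d) z‖) := by
  have hΛ : lamK lam s d = s ^ (4 - d) * lam := by
    unfold lamK
    rw [show ((4 : ℤ) - d) = ((4 - d : ℕ) : ℤ) by omega, zpow_natCast]
  rw [← hΛ] at hz ⊢
  exact ineq415_of_restr45 hlam hs hL hc hp d z hz

/-! ## §4 (v1.1, append-only). (4.5) AS TYPED ⟹ (4.15) AS TYPED: from r18's `Restr45` predicate on a region -/

/-- **(4.5) ⟹ (4.15) in the typed vocabulary** (v1.1): if the fields `(f^{(k)}, ū_k, φ)` obey r18's (4.5) predicate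
`BIJ88Sect4Statements.Restr45 c p(e_k) λ_k λ s₁ s d X f ū φ` on the region `X = Λ₀^{(k−1)′}` with `λ_k = lamK λ s d`,
`s = L^kε`, `s₁ = L^{k−1}ε = s/L`, `L ≥ 1`, then at every site `x ∈ X` the field value `φ(x)` satisfies (4.15) in the form
`ineq415_of_restr45` (the case split of (4.5), `(L^{k−1}ε)^d < λ` / `≧ λ`, implies the one used there: `s^d < L^dλ` / `λ ≦ s^d`).
[cite: BalabanImbrieJaffe1988, (4.15) p.276] -/
theorem ineq415_of_Restr45 {P : Balaban1983to89.Params} {j : ℕ} (hlam : 0 < lam) (hs : 0 < s) {L c pek : ℝ}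
    (hL : 1 ≤ L) (hc : 0 ≤ c) (hp : 1 ≤ pek) (d : ℕ) {X : Finset (Balaban1983to89.Site P j)}
    {f : Balaban1983to89.Plaq P j → ℝ} {ubar : Balaban1983to89.PBond P j → ℂ} {φ : Balaban1983to89.Site P j → ℂ}
    (h45 : BIJ88Sect4Statements.Restr45 c pek (lamK lam s d) lam (s / L) s d X f ubar φ)
    {x : Balaban1983to89.Site P j} (hx : x ∈ X) :
    BIJ88Sect4Statements.Ineq415 (24 * (1 + c) ^ 4 + Real.sqrt (L ^ d) * (1 + c) ^ 2 + L ^ d / 64) (lamK lam s d) pek s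
      lam d (fun l => ‖iteratedFDeriv ℝ l (BIJ88Sect4Statements.Pk (lamK lam s d) s lam d) (φ x)‖) := by
  have hL0 : 0 < L := zero_lt_one.trans_le hL
  have hLd : 1 ≤ L ^ d := one_le_pow₀ hL
  have hdiv : (s / L) ^ d = s ^ d / L ^ d := div_pow s L d
  obtain ⟨-, -, h3, h4⟩ := h45
  refine ineq415_of_restr45 hlam hs hL0.le hc hp d (φ x) ?_
  rcases lt_or_ge ((s / L) ^ d) lam with hlt | hge
  · refine Or.inl ⟨?_, h3 hlt x hx⟩
    rw [hdiv, div_lt_iff₀ (by positivity)] at hlt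
    linarith
  · refine Or.inr ⟨?_, h4 hge x hx⟩
    rw [hdiv] at hge
    exact hge.trans (div_le_self (by positivity) hLd)

/-- p. 276, verbatim: *"Under the restrictions in χ_k, |P_k(φ_k)| ≦ cp(e_k)⁴."* — from the typed (4.5) predicate
`BIJ88Sect4Statements.Restr45` (as in `ineq415_of_Restr45`), for EVERY `d` and the explicit constant
`C = 24(1 + c)⁴ + √(L^d)(1 + c)² + L^d/64`: the case `l = 0` of (4.15) (one of the two printed regimes always applies).
Companion of r18's `claim276_of_restr45` (d = 2, 3, 4, sharper constant). [cite: BalabanImbrieJaffe1988, (4.15) p.276] -/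
theorem abs_Pk_le_of_Restr45 {P : Balaban1983to89.Params} {j : ℕ} (hlam : 0 < lam) (hs : 0 < s) {L c pek : ℝ}
    (hL : 1 ≤ L) (hc : 0 ≤ c) (hp : 1 ≤ pek) (d : ℕ) {X : Finset (Balaban1983to89.Site P j)}
    {f : Balaban1983to89.Plaq P j → ℝ} {ubar : Balaban1983to89.PBond P j → ℂ} {φ : Balaban1983to89.Site P j → ℂ}
    (h45 : BIJ88Sect4Statements.Restr45 c pek (lamK lam s d) lam (s / L) s d X f ubar φ)
    {x : Balaban1983to89.Site P j} (hx : x ∈ X) :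
    |BIJ88Sect4Statements.Pk (lamK lam s d) s lam d (φ x)| ≤
      (24 * (1 + c) ^ 4 + Real.sqrt (L ^ d) * (1 + c) ^ 2 + L ^ d / 64) * pek ^ 4 := by
  have h := ineq415_of_Restr45 hlam hs hL hc hp d h45 hx 0
  have h0 : ‖iteratedFDeriv ℝ 0 (BIJ88Sect4Statements.Pk (lamK lam s d) s lam d) (φ x)‖ =
      |BIJ88Sect4Statements.Pk (lamK lam s d) s lam d (φ x)| := by
    rw [norm_iteratedFDeriv_zero, Real.norm_eq_abs]
  simp only [h0, abs_abs, Nat.cast_zero, zero_div, Real.rpow_zero, mul_one, pow_zero, sub_zero, zpow_ofNat] at h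
  rcases le_or_gt (s ^ d) lam with hle | hlt
  · simpa using h.1 hle
  · simpa using h.2 hlt

end

end Literature.MathematicalPhysics.QuantumFieldTheory.BalabanImbrieJaffe1984to88.BIJ88Ineq415Proof
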